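import Summits.PneNP.PneNP.Theses.KarlinRubin
import Summits.PneNP.PneNP.Theorems.KarlinRubinMonotoneBlindStubWeakBlindDnf
import Summits.PneNP.PneNP.Theorems.KarlinRubinMonotoneBlindCnf

/-!
# Crux `MonotoneBlind` (stmt-PneNP-18027, route KarlinRubin), line `Sketch`: stub `stub_weakBlindCnf`

**Weak blindness of EVERY polynomial-clause monotone CNF (no quietness)** — the depth-2 dual of
`stub_weakBlindDnf`. For `0 < δ < 1/2`, `c : ℕ` and clause families `𝓒 n` (a monotone CNF on the edge slots of
`Kₙ` accepts `x` iff every clause `C ∈ 𝓒 n` has a slot on) with `#(𝓒 n) ≤ n^c` eventually: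

  `Pr_{G(n,1/2,⌈n^{1/2-δ}⌉)}[∀ C, C meets y] ≤ Pr_{G(n,1/2)}[∀ C, C meets x] + ε n` eventually, `ε n → 0`,

with `ε n = (n²)⁻¹ + 4 n⁻¹`. The per-`n` inequality is seat 0's `cnf_planted_le` (file
`KarlinRubinMonotoneBlindCnf.lean`, which needs NO quietness): if the planted graph satisfies the CNF but the noise
`x` does not, some clause dead in `x` (all slots off) is revived by a slot inside the planted set `A`; a dead WIDE
clause (`≥ L` slots) has null probability `≤ 2^{-L}` (union over `≤ n^c` clauses), and ONE CHOSEN narrow dead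
clause (`< L` slots, `≤ 2L` vertices) is touched by the independent planted `d`-set with probability
`≤ C(2L,2) d²/n²` — a bound per dead point, no union over clauses. With `L = (c+3)(⌊log₂ n⌋+1)` and
`d ≤ 2 n^{1/2-δ}` the two terms are `≤ (n²)⁻¹` and `≤ 4 n⁻¹` eventually (`eventually_H1`).

* `tendsto_inv_sq_add_four_mul_inv` — `(n²)⁻¹ + 4 n⁻¹ → 0` in `ℝ≥0∞`;
* `eventually_cnf_planted_le_null_add` — the per-`n` bound with the two error terms absorbed, eventually;
* `stub_weakBlindCnf` — the registered stub.

All `--supports stmt-PneNP-18027`; no definitions.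
-/

set_option linter.dupNamespace false -- `Summit.PneNP.PneNP.…` is the layout-mandated namespace

namespace Summit.PneNP.PneNP.Theorems.MonotoneBlind.VertexCover

open Literature.Computability.Complexity Literature.Probability.RandomGraphs.PlantedClique Filter Finset
open scoped ENNReal Topology Classical

/-! ### The error sequence -/

/-- `(n²)⁻¹ + 4 n⁻¹ → 0` in `ℝ≥0∞`. [folklore] -/
theorem tendsto_inv_sq_add_four_mul_inv :
    Tendsto (fun n : ℕ => (((n ^ 2 : ℕ) : ℝ≥0∞))⁻¹ + 4 * ((n : ℕ) : ℝ≥0∞)⁻¹) atTop (𝓝 0) := by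
  have hinv2 : Tendsto (fun n : ℕ => (((n ^ 2 : ℕ) : ℝ≥0∞))⁻¹) atTop (𝓝 0) := by
    refine tendsto_of_tendsto_of_tendsto_of_le_of_le' tendsto_const_nhds ENNReal.tendsto_inv_nat_nhds_zero
      (Eventually.of_forall fun _ => bot_le) ?_
    filter_upwards [eventually_ge_atTop 1] with n hn
    apply ENNReal.inv_le_inv.2
    exact_mod_cast (Nat.le_self_pow two_ne_zero n)
  have hinv1 : Tendsto (fun n : ℕ => (4 : ℝ≥0∞) * ((n : ℕ) : ℝ≥0∞)⁻¹) atTop (𝓝 0) := by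
    have h := ENNReal.Tendsto.const_mul ENNReal.tendsto_inv_nat_nhds_zero
      (Or.inr ENNReal.ofNat_ne_top : (0 : ℝ≥0∞) ≠ 0 ∨ (4 : ℝ≥0∞) ≠ ⊤)
    simpa using h
  simpa using hinv2.add hinv1

/-! ### The per-`n` bound, eventually -/

/-- **Planted ≤ null + (n²)⁻¹ + 4 n⁻¹, eventually.** `cnf_planted_le` with `L = (c+3)(⌊log₂ n⌋+1)`:
`#𝓒 · 2^{-L} ≤ n^c (n^{c+2})⁻¹ = (n²)⁻¹` and `C(2L,2) d² / n² ≤ 4 n⁻¹` from `(2 ⌊log₂ n⌋⁴ d)² ≤ n`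
(`eventually_H1`) and `L ≤ 2 ⌊log₂ n⌋⁴` once `c + 3 ≤ ⌊log₂ n⌋`. [folklore] -/
theorem eventually_cnf_planted_le_null_add {δ : ℝ} (hδ : 0 < δ) (hδ' : δ < 1 / 2) (c : ℕ)
    (𝓒 : (n : ℕ) → Finset (Finset (⊤ : SimpleGraph (Fin n)).edgeSet))
    (hM : ∀ᶠ n : ℕ in atTop, #(𝓒 n) ≤ n ^ c) :
    ∀ᶠ n : ℕ in atTop,
      (plantedCliqueDist n ⌈(n : ℝ) ^ (1 / 2 - δ)⌉₊).toOuterMeasure {x | ∀ C ∈ 𝓒 n, ∃ e ∈ C, x e = true} ≤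
        (erdosRenyiHalf n).toOuterMeasure {x | ∀ C ∈ 𝓒 n, ∃ e ∈ C, x e = true} +
          ((((n ^ 2 : ℕ) : ℝ≥0∞))⁻¹ + 4 * ((n : ℕ) : ℝ≥0∞)⁻¹) := by
  have hL : ∀ᶠ n : ℕ in atTop, c + 3 ≤ Nat.log 2 n := by
    filter_upwards [eventually_ge_atTop (2 ^ (c + 3))] with n hn
    exact Nat.le_log_of_pow_le one_lt_two hn
  filter_upwards [hM, eventually_H1 hδ hδ', hL, eventually_ge_atTop 1] with n hMn H1 hLn hn1
  set ℓ := Nat.log 2 n with hℓ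
  set L := (c + 3) * (ℓ + 1) with hLdef
  set d := min ⌈(n : ℝ) ^ (1 / 2 - δ)⌉₊ n with hd
  -- `#𝓒 · 2^{-L} ≤ n^c · (n^{c+2})⁻¹ = (n²)⁻¹`
  have hwide : (#(𝓒 n) : ℝ≥0∞) * 2⁻¹ ^ L ≤ (((n ^ 2 : ℕ) : ℝ≥0∞))⁻¹ := by
    have h2L : (2⁻¹ : ℝ≥0∞) ^ L ≤ (((n ^ (c + 2) : ℕ) : ℝ≥0∞))⁻¹ :=
      half_pow_le_inv_natCast (pow_le_two_pow_mul_log_succ n c)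
    have h0 : ((n ^ c : ℕ) : ℝ≥0∞) ≠ 0 := by exact_mod_cast (pow_pos hn1 c).ne'
    have htop : ((n ^ c : ℕ) : ℝ≥0∞) ≠ ⊤ := ENNReal.natCast_ne_top _
    calc (#(𝓒 n) : ℝ≥0∞) * 2⁻¹ ^ L ≤ ((n ^ c : ℕ) : ℝ≥0∞) * (((n ^ (c + 2) : ℕ) : ℝ≥0∞))⁻¹ :=
          mul_le_mul' (by exact_mod_cast hMn) h2L
      _ = (((n ^ 2 : ℕ) : ℝ≥0∞))⁻¹ := by
          have hsplit : ((n ^ (c + 2) : ℕ) : ℝ≥0∞) = ((n ^ c : ℕ) : ℝ≥0∞) * ((n ^ 2 : ℕ) : ℝ≥0∞) := by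
            rw [pow_add, Nat.cast_mul]
          rw [hsplit, ENNReal.mul_inv (Or.inl h0) (Or.inl htop), ← mul_assoc, ENNReal.mul_inv_cancel h0 htop,
            one_mul]
  -- `C(2L,2) d² / n² ≤ 4 n⁻¹`, from `(2 ℓ⁴ d)² ≤ n` and `L ≤ 2 ℓ⁴`
  have hnarrow : (((2 * L).choose 2 * d ^ 2 : ℕ) : ℝ≥0∞) / ((n ^ 2 : ℕ) : ℝ≥0∞) ≤ 4 * ((n : ℕ) : ℝ≥0∞)⁻¹ := by
    have hLℓ : L ≤ 2 * ℓ ^ 4 := by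
      have h1 : (c + 3) * (ℓ + 1) ≤ ℓ * (ℓ + 1) := Nat.mul_le_mul_right _ hLn
      have h2 : ℓ * (ℓ + 1) ≤ 2 * ℓ ^ 4 := by
        have : 1 ≤ ℓ := le_trans (by omega : 1 ≤ c + 3) hLn
        nlinarith [Nat.one_le_pow 2 ℓ this, Nat.one_le_pow 3 ℓ this]
      exact h1.trans h2
    have hA : (2 * L).choose 2 * d ^ 2 ≤ 4 * n :=
      calc (2 * L).choose 2 * d ^ 2 ≤ (2 * L) ^ 2 * d ^ 2 := Nat.mul_le_mul_right _ (Nat.choose_le_pow _ _)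
        _ = (2 * L * d) ^ 2 := by ring
        _ ≤ (2 * (2 * ℓ ^ 4) * d) ^ 2 := by gcongr
        _ = 4 * (2 * ℓ ^ 4 * d) ^ 2 := by ring
        _ ≤ 4 * n := Nat.mul_le_mul_left 4 H1
    have hn0 : ((n : ℕ) : ℝ≥0∞) ≠ 0 := by exact_mod_cast (show n ≠ 0 by omega)
    have hntop : ((n : ℕ) : ℝ≥0∞) ≠ ⊤ := ENNReal.natCast_ne_top _
    have hn2 : ((n ^ 2 : ℕ) : ℝ≥0∞) ≠ 0 := by exact_mod_cast (pow_pos hn1 2).ne'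
    rw [ENNReal.div_le_iff hn2 (ENNReal.natCast_ne_top _)]
    calc (((2 * L).choose 2 * d ^ 2 : ℕ) : ℝ≥0∞) ≤ ((4 * n : ℕ) : ℝ≥0∞) := by exact_mod_cast hA
      _ = 4 * ((n : ℕ) : ℝ≥0∞)⁻¹ * ((n ^ 2 : ℕ) : ℝ≥0∞) := by
          push_cast
          rw [sq, ← mul_assoc, mul_assoc 4, ENNReal.inv_mul_cancel hn0 hntop, mul_one]
  refine (cnf_planted_le hn1 _ L (𝓒 n)).trans ?_
  rw [add_assoc]
  exact add_le_add le_rfl (add_le_add hwide hnarrow)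

/-! ### The theorem -/

/-- **stub_weakBlindCnf** (stub of line `Sketch` of crux stmt-PneNP-18027; weak blindness of EVERY
polynomial-clause monotone CNF, no quietness — the depth-2 dual of `stub_weakBlindDnf`). For `δ ∈ (0,1/2)`, `c`,
clause families `𝓒 n` with `#(𝓒 n) ≤ n^c` eventually: `Pr_planted[∀ C ∈ 𝓒 n, some slot of C on] ≤
Pr_null[same] + ε n` eventually, `ε n → 0`, with `ε n = (n²)⁻¹ + 4 n⁻¹`. Proof: a dead noise has a DEAD clause
(all slots off); revival by the planted clique needs a slot of ONE FIXED dead clause inside `A`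
(probability `≤ C(2L,2) d²/n²` if it is narrower than `L = (c+3)(⌊log₂ n⌋+1)`), and noises with a wide dead
clause have probability `≤ n^c 2^{-L} ≤ (n²)⁻¹` (`cnf_planted_le`, `eventually_cnf_planted_le_null_add`).
[folklore] -/
theorem stub_weakBlindCnf :
    ∀ δ : ℝ, 0 < δ → δ < 1 / 2 → ∀ c : ℕ,
      ∀ 𝓒 : (n : ℕ) → Finset (Finset ((⊤ : SimpleGraph (Fin n)).edgeSet)),
      (∀ᶠ n : ℕ in atTop, #(𝓒 n) ≤ n ^ c) →
      ∃ ε : ℕ → ℝ≥0∞, Tendsto ε atTop (𝓝 0) ∧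
        ∀ᶠ n : ℕ in atTop,
          (plantedCliqueDist n ⌈(n : ℝ) ^ (1 / 2 - δ)⌉₊).toOuterMeasure
              {x | ∀ C ∈ 𝓒 n, ∃ e ∈ C, x e = true} ≤
            (erdosRenyiHalf n).toOuterMeasure {x | ∀ C ∈ 𝓒 n, ∃ e ∈ C, x e = true} + ε n := by
  intro δ hδ hδ' c 𝓒 hM
  exact ⟨fun n => (((n ^ 2 : ℕ) : ℝ≥0∞))⁻¹ + 4 * ((n : ℕ) : ℝ≥0∞)⁻¹, tendsto_inv_sq_add_four_mul_inv,
    eventually_cnf_planted_le_null_add hδ hδ' c 𝓒 hM⟩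

end Summit.PneNP.PneNP.Theorems.MonotoneBlind.VertexCover
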